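import Mathlib
import Summits.Ventures.PercRepro.PuncturedLYMUnif56Table
import Summits.Ventures.PercRepro.PuncturedLYMUnif56PosDen1
import Summits.Ventures.PercRepro.PuncturedLYMUnif56PosCls1

/-!
# PercRepro — (SP) FOR ANY NUMBER OF PAIRWISE DISJOINT `5`-SETS AT LEVEL `6`: POSITIVITY OF THE TABLE
(p10, gen 40)

The positivity of the denominators `Qp`, `Pp` and of `Yc`, `Pc` for `n ≥ 7`, `5k ≤ n`; `sel_nonneg` (by the class guards) and `raw_nonneg`.  Nothing here asserts (SP).
-/

namespace PercRepro.PuncturedLYM.Split.TypeLift.Unif56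

/-- Every numerator of the table is nonnegative on its class. -/
theorem sel_nonneg (n k : ℚ) (c1 c2 c3 c4 v : ℕ) (hn : 7 ≤ n) (hk1 : k = 0 ∨ 1 ≤ k) (hk : (c1 : ℚ) + c2 + c3 + c4 ≤ k)
    (hf : (6 : ℚ) - c1 - 2 * c2 - 3 * c3 - 4 * c4 ≤ n - 5 * k) : 0 ≤ sel c1 c2 c3 c4 v n k := by
  unfold sel
  by_cases g1 : c1 = 0 ∧ c2 = 0 ∧ c3 = 0 ∧ c4 = 0
  · rw [if_pos g1]
    obtain ⟨rfl, rfl, rfl, rfl⟩ := g1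
    exact sel_0000_nonneg n k v hn hk1 (by push_cast at hk; linarith) (by push_cast at hf; linarith)
  rw [if_neg g1]
  by_cases g2 : c1 = 1 ∧ c2 = 0 ∧ c3 = 0 ∧ c4 = 0
  · rw [if_pos g2]
    obtain ⟨rfl, rfl, rfl, rfl⟩ := g2
    exact sel_1000_nonneg n k v (by push_cast at hk; linarith) (by push_cast at hf; linarith)
  rw [if_neg g2]
  by_cases g3 : c1 = 0 ∧ c2 = 1 ∧ c3 = 0 ∧ c4 = 0
  · rw [if_pos g3]
    obtain ⟨rfl, rfl, rfl, rfl⟩ := g3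
    exact sel_0100_nonneg n k v (by push_cast at hk; linarith) (by push_cast at hf; linarith)
  rw [if_neg g3]
  by_cases g4 : c1 = 2 ∧ c2 = 0 ∧ c3 = 0 ∧ c4 = 0
  · rw [if_pos g4]
    obtain ⟨rfl, rfl, rfl, rfl⟩ := g4
    exact sel_2000_nonneg n k v (by push_cast at hk; linarith) (by push_cast at hf; linarith)
  rw [if_neg g4]
  by_cases g5 : c1 = 0 ∧ c2 = 0 ∧ c3 = 1 ∧ c4 = 0
  · rw [if_pos g5]
    obtain ⟨rfl, rfl, rfl, rfl⟩ := g5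
    exact sel_0010_nonneg n k v (by push_cast at hk; linarith) (by push_cast at hf; linarith)
  rw [if_neg g5]
  by_cases g6 : c1 = 1 ∧ c2 = 1 ∧ c3 = 0 ∧ c4 = 0
  · rw [if_pos g6]
    obtain ⟨rfl, rfl, rfl, rfl⟩ := g6
    exact sel_1100_nonneg n k v (by push_cast at hk; linarith) (by push_cast at hf; linarith)
  rw [if_neg g6]
  by_cases g7 : c1 = 3 ∧ c2 = 0 ∧ c3 = 0 ∧ c4 = 0
  · rw [if_pos g7]
    obtain ⟨rfl, rfl, rfl, rfl⟩ := g7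
    exact sel_3000_nonneg n k v (by push_cast at hk; linarith) (by push_cast at hf; linarith)
  rw [if_neg g7]
  by_cases g8 : c1 = 0 ∧ c2 = 0 ∧ c3 = 0 ∧ c4 = 1
  · rw [if_pos g8]
    obtain ⟨rfl, rfl, rfl, rfl⟩ := g8
    exact sel_0001_nonneg n k v (by push_cast at hk; linarith) (by push_cast at hf; linarith)
  rw [if_neg g8]
  by_cases g9 : c1 = 0 ∧ c2 = 2 ∧ c3 = 0 ∧ c4 = 0
  · rw [if_pos g9]
    obtain ⟨rfl, rfl, rfl, rfl⟩ := g9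
    exact sel_0200_nonneg n k v (by push_cast at hk; linarith) (by push_cast at hf; linarith)
  rw [if_neg g9]
  by_cases g10 : c1 = 1 ∧ c2 = 0 ∧ c3 = 1 ∧ c4 = 0
  · rw [if_pos g10]
    obtain ⟨rfl, rfl, rfl, rfl⟩ := g10
    exact sel_1010_nonneg n k v (by push_cast at hk; linarith) (by push_cast at hf; linarith)
  rw [if_neg g10]
  by_cases g11 : c1 = 2 ∧ c2 = 1 ∧ c3 = 0 ∧ c4 = 0
  · rw [if_pos g11]
    obtain ⟨rfl, rfl, rfl, rfl⟩ := g11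
    exact sel_2100_nonneg n k v (by push_cast at hk; linarith) (by push_cast at hf; linarith)
  rw [if_neg g11]
  by_cases g12 : c1 = 4 ∧ c2 = 0 ∧ c3 = 0 ∧ c4 = 0
  · rw [if_pos g12]
    obtain ⟨rfl, rfl, rfl, rfl⟩ := g12
    exact sel_4000_nonneg n k v (by push_cast at hk; linarith) (by push_cast at hf; linarith)
  rw [if_neg g12]
  by_cases g13 : c1 = 0 ∧ c2 = 1 ∧ c3 = 1 ∧ c4 = 0
  · rw [if_pos g13]
    obtain ⟨rfl, rfl, rfl, rfl⟩ := g13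
    exact sel_0110_nonneg n k v (by push_cast at hk; linarith) (by push_cast at hf; linarith)
  rw [if_neg g13]
  by_cases g14 : c1 = 1 ∧ c2 = 0 ∧ c3 = 0 ∧ c4 = 1
  · rw [if_pos g14]
    obtain ⟨rfl, rfl, rfl, rfl⟩ := g14
    exact sel_1001_nonneg n k v (by push_cast at hk; linarith) (by push_cast at hf; linarith)
  rw [if_neg g14]
  by_cases g15 : c1 = 1 ∧ c2 = 2 ∧ c3 = 0 ∧ c4 = 0
  · rw [if_pos g15]
    obtain ⟨rfl, rfl, rfl, rfl⟩ := g15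
    exact sel_1200_nonneg n k v (by push_cast at hk; linarith) (by push_cast at hf; linarith)
  rw [if_neg g15]
  by_cases g16 : c1 = 2 ∧ c2 = 0 ∧ c3 = 1 ∧ c4 = 0
  · rw [if_pos g16]
    obtain ⟨rfl, rfl, rfl, rfl⟩ := g16
    exact sel_2010_nonneg n k v (by push_cast at hk; linarith) (by push_cast at hf; linarith)
  rw [if_neg g16]
  by_cases g17 : c1 = 3 ∧ c2 = 1 ∧ c3 = 0 ∧ c4 = 0
  · rw [if_pos g17]
    obtain ⟨rfl, rfl, rfl, rfl⟩ := g17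
    exact sel_3100_nonneg n k v (by push_cast at hk; linarith) (by push_cast at hf; linarith)
  rw [if_neg g17]
  by_cases g18 : c1 = 5 ∧ c2 = 0 ∧ c3 = 0 ∧ c4 = 0
  · rw [if_pos g18]
    obtain ⟨rfl, rfl, rfl, rfl⟩ := g18
    exact sel_5000_nonneg n k v (by push_cast at hk; linarith) (by push_cast at hf; linarith)
  rw [if_neg g18]
  by_cases g19 : c1 = 0 ∧ c2 = 0 ∧ c3 = 2 ∧ c4 = 0
  · rw [if_pos g19]
    obtain ⟨rfl, rfl, rfl, rfl⟩ := g19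
    exact sel_0020_nonneg n k v (by push_cast at hk; linarith) (by push_cast at hf; linarith)
  rw [if_neg g19]
  by_cases g20 : c1 = 0 ∧ c2 = 1 ∧ c3 = 0 ∧ c4 = 1
  · rw [if_pos g20]
    obtain ⟨rfl, rfl, rfl, rfl⟩ := g20
    exact sel_0101_nonneg n k v (by push_cast at hk; linarith) (by push_cast at hf; linarith)
  rw [if_neg g20]
  by_cases g21 : c1 = 0 ∧ c2 = 3 ∧ c3 = 0 ∧ c4 = 0
  · rw [if_pos g21]
    obtain ⟨rfl, rfl, rfl, rfl⟩ := g21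
    exact sel_0300_nonneg n k v (by push_cast at hk; linarith) (by push_cast at hf; linarith)
  rw [if_neg g21]
  by_cases g22 : c1 = 1 ∧ c2 = 1 ∧ c3 = 1 ∧ c4 = 0
  · rw [if_pos g22]
    obtain ⟨rfl, rfl, rfl, rfl⟩ := g22
    exact sel_1110_nonneg n k v (by push_cast at hk; linarith) (by push_cast at hf; linarith)
  rw [if_neg g22]
  by_cases g23 : c1 = 2 ∧ c2 = 0 ∧ c3 = 0 ∧ c4 = 1
  · rw [if_pos g23]
    obtain ⟨rfl, rfl, rfl, rfl⟩ := g23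
    exact sel_2001_nonneg n k v (by push_cast at hk; linarith) (by push_cast at hf; linarith)
  rw [if_neg g23]
  by_cases g24 : c1 = 2 ∧ c2 = 2 ∧ c3 = 0 ∧ c4 = 0
  · rw [if_pos g24]
    obtain ⟨rfl, rfl, rfl, rfl⟩ := g24
    exact sel_2200_nonneg n k v (by push_cast at hk; linarith) (by push_cast at hf; linarith)
  rw [if_neg g24]
  by_cases g25 : c1 = 3 ∧ c2 = 0 ∧ c3 = 1 ∧ c4 = 0
  · rw [if_pos g25]
    obtain ⟨rfl, rfl, rfl, rfl⟩ := g25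
    exact sel_3010_nonneg n k v (by push_cast at hk; linarith) (by push_cast at hf; linarith)
  rw [if_neg g25]
  by_cases g26 : c1 = 4 ∧ c2 = 1 ∧ c3 = 0 ∧ c4 = 0
  · rw [if_pos g26]
    obtain ⟨rfl, rfl, rfl, rfl⟩ := g26
    exact sel_4100_nonneg n k v (by push_cast at hk; linarith) (by push_cast at hf; linarith)
  rw [if_neg g26]
  by_cases g27 : c1 = 6 ∧ c2 = 0 ∧ c3 = 0 ∧ c4 = 0
  · rw [if_pos g27]
    obtain ⟨rfl, rfl, rfl, rfl⟩ := g27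
    exact sel_6000_nonneg n k v (by push_cast at hk; linarith) (by push_cast at hf; linarith)
  rw [if_neg g27]

/-- The unnormalised weights are nonnegative on their classes. -/
theorem raw_nonneg (n k : ℚ) (c1 c2 c3 c4 v : ℕ) (hn : 7 ≤ n) (hk3 : 5 * k ≤ n) (hk2 : k = 0 ∨ k = 1 ∨ 2 ≤ k)
    (hk : (c1 : ℚ) + c2 + c3 + c4 ≤ k) (hf : (6 : ℚ) - c1 - 2 * c2 - 3 * c3 - 4 * c4 ≤ n - 5 * k) : 0 ≤ raw n k c1 c2 c3 c4 v := by
  unfold raw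
  have hk1 : k = 0 ∨ 1 ≤ k := by
    rcases hk2 with h | h | h
    · exact Or.inl h
    · exact Or.inr (by linarith)
    · exact Or.inr (by linarith)
  have hQ := Qp_pos n k hn hk2 hk3
  have hP := Pp_pos n k hn hk3
  exact div_nonneg (sel_nonneg n k c1 c2 c3 c4 v hn hk1 hk hf) (by positivity)

end PercRepro.PuncturedLYM.Split.TypeLift.Unif56
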